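import Mathlib
import HarnessLib
import Summits.Ventures.LatticeQCDFlow.Scaling.EntropyMarginalCloseness
import Summits.Ventures.LatticeQCDFlow.Scaling.EntropyLagLawDoeblin
import Summits.Ventures.LatticeQCDFlow.Scaling.LinearFamilyTilt

/-!
# EntropyMarginalClosenessDoeblin — the marginals of the switching protocol under DOEBLIN layers:
# `KL(μ_j ‖ π_j) ≤ δ²ΔD²(1 − ε)(2 − ε)/(4ε²)` and, for every bounded observable,
# `|E_{μ_j} O − ⟨O⟩_{c_j}| ≤ ΔO·√(KL(μ_j ‖ π_j)/2)` — the unweighted end-point ensemble is within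
# `O(δ·ΔD·ΔO/ε)` of the target, polynomially in `1/n`, no sup-norm factor

HONEST FRAMING: exact (Metropolis-corrected) sampling algorithms for lattice gauge theory;
figures of merit are autocorrelation/cost numbers at stated couplings and volumes; no
continuum-physics claim.

Venture `LatticeQCDFlow` (cell pub-lqcd), topic `Scaling`; FANOUT row 19 (`su2-snf`, GEN-9).  OUR
WORK; nothing is cited as a fact (Mathlib's Hoeffding lemma enters through
`Scaling/EntropyLagLawDoeblin.log_sum_mul_exp_le_hoeffding`).  Packaging of
`Scaling/EntropyMarginalCloseness` with the dischargeable inputs of `Scaling/EntropyLagLawDoeblin`: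

* `klFin_gibbs_step_eq_log`, **`klFin_gibbs_step_le_hoeffding`** — THE QUASI-STATIC STEP IS A
  LOG-MGF: `KL(π_a ‖ π_b) = log Σ π_a e^{−(b−a)(D − ⟨D⟩_a)} ≤ (b−a)²ΔD²/8` (`|D x − D y| ≤ ΔD`);
* **`klFin_evolveLaw_le_doeblin`** — uniform grid `c_{k+1} − c_k = δ > 0`, layers row-stochastic,
  stationary for and minorised by their targets (`P_k(x, ·) ≥ ε·π_{k+1}`, `0 < ε < 1`):
  `KL(μ_j ‖ π_j) ≤ δ²ΔD²(1 − ε)(2 − ε)/(4ε²)` for every `j ≤ n`;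
* **`abs_sum_evolveLaw_sub_gibbsMean_le_sqrt`** — for every observable with `|O x − O y| ≤ ΔO`,
  `ΔO ≥ 0`, and every `j`: `|E_{μ_j} O − ⟨O⟩_{c_j}| ≤ ΔO·√(KL(μ_j ‖ π_j)/2)` (the Gibbs variational
  inequality with Hoeffding for `O`, optimised in `λ'` — a transport / Pinsker-type form);
* **`abs_sum_evolveLaw_sub_gibbsMean_le_doeblin`** — the two combined:
  `|E_{μ_j} O − ⟨O⟩_{c_j}| ≤ ΔO·√(δ²ΔD²(1 − ε)(2 − ε)/(8ε²))`.

Reading (value-free): for the unit span the weights-dropped (X-3 / INVALID-3) arm's end-point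
observables are within `ΔO·ΔD·√((1−ε)(2−ε)/8)/(n·ε)` of the target means — an observable `z`-test
cannot flag it at production `n_step`; the weight bookkeeping remains the detector (row 19 P6/P18).
NOT CLAIMED: `ε` for any lattice sweep; numbers.
-/

namespace Summit.Ventures.LatticeQCDFlow.Scaling

open Finset
open Literature.Probability.MarkovChains (IsRowStochastic stepLaw stepLaw_nonneg sum_stepLaw)
open Summit.Ventures.LatticeQCDFlow.Exactness
open Summit.Ventures.LatticeQCDFlow.Theory2

variable {X : Type*} [Fintype X]

/-! ## §1 The quasi-static step is a log-MGF -/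

/-- **`KL(π_a ‖ π_b) = log Σ_y π_a(y) e^{−(b−a)(D y − ⟨D⟩_a)}`** for the linear family. [ours] -/
theorem klFin_gibbs_step_eq_log [Nonempty X] (S₀ D : X → ℝ) (a b : ℝ) :
    klFin (gibbsLaw (linAction S₀ D a)) (gibbsLaw (linAction S₀ D b))
      = Real.log (∑ y, gibbsLaw (linAction S₀ D a) y
          * Real.exp (-(b - a) * (D y - meanD S₀ D a))) := by
  rw [klFin_gibbsLaw_linAction]
  have hsum : ∑ y, gibbsLaw (linAction S₀ D a) y * Real.exp (-(b - a) * (D y - meanD S₀ D a))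
      = Real.exp ((b - a) * meanD S₀ D a)
        * (partitionFn (linAction S₀ D b) / partitionFn (linAction S₀ D a)) := by
    have h := sum_gibbsLaw_linAction_mul_exp S₀ D a (b - a)
    rw [show a + (b - a) = b by ring] at h
    rw [← h, mul_sum]
    refine sum_congr rfl fun y _ => ?_
    rw [mul_left_comm, ← Real.exp_add]
    congr 2
    ring
  rw [hsum, Real.log_mul (Real.exp_pos _).ne'
      (div_pos (partitionFn_pos _) (partitionFn_pos _)).ne', Real.log_exp,
    Real.log_div (partitionFn_pos _).ne' (partitionFn_pos _).ne']
  unfold linFreeEnergy freeEnergy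
  ring

/-- **`KL(π_a ‖ π_b) ≤ (b − a)²·ΔD²/8`** when `|D x − D y| ≤ ΔD` (Hoeffding). [ours] -/
theorem klFin_gibbs_step_le_hoeffding [Nonempty X] (S₀ D : X → ℝ) {ΔD : ℝ}
    (hD : ∀ x y, |D x - D y| ≤ ΔD) (a b : ℝ) :
    klFin (gibbsLaw (linAction S₀ D a)) (gibbsLaw (linAction S₀ D b)) ≤ (b - a) ^ 2 * ΔD ^ 2 / 8 := by
  rw [klFin_gibbs_step_eq_log]
  have h := log_sum_gibbs_exp_le_hoeffding S₀ D hD a (-(b - a))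
  rwa [neg_sq] at h

/-! ## §2 Relative entropy of the marginals under Doeblin layers -/

section Law

variable [Nonempty X] (S₀ D : X → ℝ) (c : ℕ → ℝ) (P : ℕ → X → X → ℝ)

/-- **`KL(μ_j ‖ π_j) ≤ δ²ΔD²(1 − ε)(2 − ε)/(4ε²)`** for every marginal of the protocol with Doeblin
layers (`P_k(x, ·) ≥ ε·π_{k+1}`, stationary, `0 < ε < 1`), uniform grid `δ`, `|D x − D y| ≤ ΔD`. [ours] -/
theorem klFin_evolveLaw_le_doeblin (hP : ∀ k, IsRowStochastic (P k)) {δ : ℝ} (hδ : 0 < δ)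
    (hc : ∀ k, c (k + 1) - c k = δ)
    (hst : ∀ k y, ∑ x, gibbsLaw (linAction S₀ D (c (k + 1))) x * P k x y
      = gibbsLaw (linAction S₀ D (c (k + 1))) y)
    {ε : ℝ} (hε0 : 0 < ε) (hε1 : ε < 1)
    (hmin : ∀ k x y, ε * gibbsLaw (linAction S₀ D (c (k + 1))) y ≤ P k x y)
    {ΔD : ℝ} (hD : ∀ x y, |D x - D y| ≤ ΔD) (n : ℕ) :
    ∀ j, j ≤ n → klFin (evolveLaw P (gibbsLaw (linAction S₀ D (c 0))) j)
        (gibbsLaw (linAction S₀ D (c j)))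
      ≤ δ ^ 2 * ΔD ^ 2 * (1 - ε) * (2 - ε) / (4 * ε ^ 2) := by
  have hK : ∀ k (μ : X → ℝ), (∀ x, 0 ≤ μ x) → ∑ x, μ x = 1 →
      klFin (stepLaw (P k) μ) (gibbsLaw (linAction S₀ D (c (k + 1))))
        ≤ (1 - ε) * klFin μ (gibbsLaw (linAction S₀ D (c (k + 1)))) :=
    fun k μ hμ hμ1 => klFin_stepLaw_le_of_doeblin (hP k) (gibbsLaw_pos _) (sum_gibbsLaw _) (hst k)
      hε0 hε1.le (hmin k) hμ hμ1
  have hΛ0 : 0 ≤ (2 * δ * (1 - ε) / ε) ^ 2 * ΔD ^ 2 / 8 := by positivity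
  have hq0 : 0 ≤ δ ^ 2 * ΔD ^ 2 / 8 := by positivity
  have hΛp : ∀ j, j < n → Real.log (∑ y, gibbsLaw (linAction S₀ D (c j)) y
      * Real.exp ((2 * δ * (1 - ε) / ε) * (D y - meanD S₀ D (c j))))
        ≤ (2 * δ * (1 - ε) / ε) ^ 2 * ΔD ^ 2 / 8 :=
    fun j _ => log_sum_gibbs_exp_le_hoeffding S₀ D hD (c j) _
  have hΛm : ∀ j, j < n → Real.log (∑ y, gibbsLaw (linAction S₀ D (c j)) y
      * Real.exp (-(2 * δ * (1 - ε) / ε) * (D y - meanD S₀ D (c j))))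
        ≤ (2 * δ * (1 - ε) / ε) ^ 2 * ΔD ^ 2 / 8 := by
    intro j _
    have := log_sum_gibbs_exp_le_hoeffding S₀ D hD (c j) (-(2 * δ * (1 - ε) / ε))
    rwa [neg_sq] at this
  have hq : ∀ j, j < n → klFin (gibbsLaw (linAction S₀ D (c j)))
      (gibbsLaw (linAction S₀ D (c (j + 1)))) ≤ δ ^ 2 * ΔD ^ 2 / 8 := by
    intro j _
    have h := klFin_gibbs_step_le_hoeffding S₀ D hD (c j) (c (j + 1))
    rwa [hc j] at h
  intro j hj
  have key := klFin_evolveLaw_le_of_entropy' S₀ D c P hP hδ hc hε0 hε1 hK hΛ0 hq0 n hΛp hΛm hq j hj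
  refine key.trans (le_of_eq ?_)
  field_simp
  ring

/-! ## §3 Observable closeness in the square-root (transport) form -/

/-- **`|E_{μ_j} O − ⟨O⟩_{c_j}| ≤ ΔO·√(KL(μ_j ‖ π_j)/2)`** for every observable with
`|O x − O y| ≤ ΔO` (`ΔO ≥ 0`): the Gibbs variational inequality with the Hoeffding envelope of `O`,
optimised over `λ'`. [ours] -/
theorem abs_sum_evolveLaw_sub_gibbsMean_le_sqrt (hP : ∀ k, IsRowStochastic (P k)) (O : X → ℝ)
    {ΔO : ℝ} (hΔO : 0 ≤ ΔO) (hO : ∀ x y, |O x - O y| ≤ ΔO) (j : ℕ) :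
    |∑ y, evolveLaw P (gibbsLaw (linAction S₀ D (c 0))) j y * O y
        - gibbsMean (linAction S₀ D (c j)) O|
      ≤ ΔO * Real.sqrt (klFin (evolveLaw P (gibbsLaw (linAction S₀ D (c 0))) j)
          (gibbsLaw (linAction S₀ D (c j))) / 2) := by
  set K := klFin (evolveLaw P (gibbsLaw (linAction S₀ D (c 0))) j)
    (gibbsLaw (linAction S₀ D (c j))) with hKdef
  set b := |∑ y, evolveLaw P (gibbsLaw (linAction S₀ D (c 0))) j y * O y
    - gibbsMean (linAction S₀ D (c j)) O| with hb
  have hK0 : 0 ≤ K := klFin_nonneg (evolveLaw_nonneg S₀ D c P hP j) (gibbsLaw_pos _)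
    (by rw [sum_evolveLaw_gibbs S₀ D c P hP j, sum_gibbsLaw])
  -- the `λ'`-family of bounds: `b ≤ K/λ' + λ' ΔO²/8`
  have hfam : ∀ lam' : ℝ, 0 < lam' → b ≤ K / lam' + lam' * ΔO ^ 2 / 8 := by
    intro lam' hlam
    have hH : ∀ t : ℝ, Real.log (∑ y, gibbsLaw (linAction S₀ D (c j)) y
        * Real.exp (t * (O y - gibbsMean (linAction S₀ D (c j)) O))) ≤ t ^ 2 * ΔO ^ 2 / 8 :=
      fun t => log_sum_mul_exp_le_hoeffding (fun x => (gibbsLaw_pos _ x).le) (sum_gibbsLaw _) O hO t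
    have h1 := abs_sum_evolveLaw_sub_gibbsMean_le S₀ D c P hP O hlam j (hH lam')
      (by have := hH (-lam'); rwa [neg_sq] at this)
    calc b ≤ (K + lam' ^ 2 * ΔO ^ 2 / 8) / lam' := h1
      _ = K / lam' + lam' * ΔO ^ 2 / 8 := by field_simp
  -- optimise: for every `η > 0`, `b ≤ ΔO √(K/2) + η`
  refine le_of_forall_pos_le_add fun η hη => ?_
  rcases eq_or_lt_of_le hK0 with hK | hK
  · -- `K = 0`: take `λ'` small
    have h := hfam (8 * η / (ΔO ^ 2 + 1)) (by positivity)
    rw [← hK] at h ⊢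
    rw [zero_div, Real.sqrt_zero, mul_zero, zero_add]
    rw [zero_div, zero_add] at h
    have hle : 8 * η / (ΔO ^ 2 + 1) * ΔO ^ 2 / 8 ≤ η := by
      rw [div_mul_eq_mul_div, div_div, div_le_iff₀ (by positivity)]
      nlinarith [sq_nonneg ΔO]
    exact h.trans hle
  · rcases eq_or_lt_of_le hΔO with hΔ | hΔ
    · -- `ΔO = 0`: take `λ'` large
      have h := hfam (K / η) (div_pos hK hη)
      rw [← hΔ] at h ⊢
      have hval : K / (K / η) + K / η * (0:ℝ) ^ 2 / 8 = η := by
        field_simp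
        ring
      rw [hval] at h
      rw [zero_mul]
      linarith
    · -- generic case: `λ' = √(8K)/ΔO`
      set s := Real.sqrt (8 * K) with hs_def
      have hs : 0 < s := Real.sqrt_pos.2 (by positivity)
      have h := hfam (s / ΔO) (div_pos hs hΔ)
      have hsq : s ^ 2 = 8 * K := Real.sq_sqrt (by positivity)
      have h2 : Real.sqrt (K / 2) = s / 4 := by
        rw [hs_def, show K / 2 = 8 * K / 16 by ring, Real.sqrt_div' _ (by norm_num : (0:ℝ) ≤ 16),
          show (16:ℝ) = 4 ^ 2 by norm_num, Real.sqrt_sq (by norm_num : (0:ℝ) ≤ 4)]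
      have e1 : K / (s / ΔO) = s * ΔO / 8 := by
        rw [div_div_eq_mul_div, div_eq_div_iff hs.ne' (by norm_num : (8:ℝ) ≠ 0)]
        linear_combination (-ΔO) * hsq
      have e2 : s / ΔO * ΔO ^ 2 / 8 = s * ΔO / 8 := by
        field_simp
      rw [e1, e2] at h
      rw [h2]
      linarith

/-- **THE UNWEIGHTED ENSEMBLE UNDER DOEBLIN LAYERS**: for every observable with `|O x − O y| ≤ ΔO`
and every `j ≤ n`: `|E_{μ_j} O − ⟨O⟩_{c_j}| ≤ ΔO·√(δ²ΔD²(1−ε)(2−ε)/(8ε²))`. [ours] -/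
theorem abs_sum_evolveLaw_sub_gibbsMean_le_doeblin (hP : ∀ k, IsRowStochastic (P k)) {δ : ℝ}
    (hδ : 0 < δ) (hc : ∀ k, c (k + 1) - c k = δ)
    (hst : ∀ k y, ∑ x, gibbsLaw (linAction S₀ D (c (k + 1))) x * P k x y
      = gibbsLaw (linAction S₀ D (c (k + 1))) y)
    {ε : ℝ} (hε0 : 0 < ε) (hε1 : ε < 1)
    (hmin : ∀ k x y, ε * gibbsLaw (linAction S₀ D (c (k + 1))) y ≤ P k x y)
    {ΔD : ℝ} (hD : ∀ x y, |D x - D y| ≤ ΔD) (O : X → ℝ) {ΔO : ℝ} (hΔO : 0 ≤ ΔO)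
    (hO : ∀ x y, |O x - O y| ≤ ΔO) (n : ℕ) :
    ∀ j, j ≤ n → |∑ y, evolveLaw P (gibbsLaw (linAction S₀ D (c 0))) j y * O y
        - gibbsMean (linAction S₀ D (c j)) O|
      ≤ ΔO * Real.sqrt (δ ^ 2 * ΔD ^ 2 * (1 - ε) * (2 - ε) / (8 * ε ^ 2)) := by
  intro j hj
  have h1 := abs_sum_evolveLaw_sub_gibbsMean_le_sqrt S₀ D c P hP O hΔO hO j
  have h2 := klFin_evolveLaw_le_doeblin S₀ D c P hP hδ hc hst hε0 hε1 hmin hD n j hj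
  refine h1.trans (mul_le_mul_of_nonneg_left (Real.sqrt_le_sqrt ?_) hΔO)
  have : δ ^ 2 * ΔD ^ 2 * (1 - ε) * (2 - ε) / (8 * ε ^ 2)
      = δ ^ 2 * ΔD ^ 2 * (1 - ε) * (2 - ε) / (4 * ε ^ 2) / 2 := by ring
  rw [this]
  exact div_le_div_of_nonneg_right h2 (by norm_num)

end Law

end Summit.Ventures.LatticeQCDFlow.Scaling
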